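import Summits.CriticalPhenomena.PercolationContinuityZ3.Theorems.PercNearOneGluingNoHeavyQuantHeavyPairWeights
import HarnessLib

/-!
# QUANT lane R8, T-DEC: the UNIFORM-SPREADING certificate — a law is HEAVY at `(x, T)` as soon as its low atoms can be served by
# uniform fractions `c_l` of the admissible high atoms at the cheapest gates, `Σ c_l ≤ 1` (prim-quant-census-2 gen 82, file 3)

builds on p205010 (kernel theorem, internal audit signed; external expert review pending)

Support file (`--supports stmt-CriticalPhenomena-4575`), QUANT lane census seat prim-quant-census-2 (gen 82); memo
`run/shared/lean/prim/quant/prim-quant-census-2-g82/REFLECTION-G82.md` §3.  Theorems only, standard axioms, no sorries, no definitions.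

THE CERTIFICATE.  Law `μ ≥ 0` on `{0..M}` (mass 1), floor `0 ≤ x ≤ 1`, target `T`.  A low atom `l` (`2l < T`) may be paired with a high atom
`h > T − l` (`h ≤ M`) at the CHEAPEST admissible gate `γ_{lh} = max(x, (T − 2l)/(h − l))` (floor, resp. exact credit `2l + (h−l)γ = T`); one unit
of `μ h` then carries `ρ_{lh} = (1 − γ_{lh})/γ_{lh}` units of low mass.  UNIFORM SPREADING: low `l` takes the same fraction `c_l ≥ 0` of EVERY
admissible high atom, i.e. `c_l · Σ_{h > T−l} μ h · ρ_{lh} = μ l`; this is a heavy decomposition as soon as **`Σ_l c_l ≤ 1`** (every high atom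
is loaded by at most its mass).
* **`heavy_of_uniformSpread`** — the statement above, concluded in the inline heavy `∃` of `decAtT_of_heavy` (via `heavy_of_pairWeights` with the
  weight table `w l h = [2l < T, T−l < h ≤ M]·c_l·μ h/γ_{lh}`); `decAtT_of_uniformSpread`: DEC at every layer.
WHY (memo §3, census — guidance only).  For `n` blobs of a common size (Poisson-binomial law `P`, `T = s = Σgᵢ`, `x = s/n`, `M = n`) the
uniform-spreading load `Σ_{b<s/2} P_b/T_b`, `T_b = Σ_{h>s−b} P_h·min((h+b−s)/(s−2b), (n−s)/s)`, equals `1` identically for `s ≤ 1`, equals the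
zero-only-low certificate `s·P₀/U ≤ 1` of `heavy_of_zeroLow` for `s ≤ 2`, and is NUMERICALLY `< 1` for every gate vector tried with `s > 2`
(binomial `n ≤ 80`: 6 402 band cells, max 0.617; `(g,…,g,cg)` grids `n ≤ 30`: max 0.762; 30 000 random/extreme vectors `n ≤ 16`: max 0.815;
adversarial hill-climbs `n = 3..12`: sup ≈ 0.845 at `n = 3`, `s ↓ 2`, decreasing in `n`) — CONJECTURE C (memo §3): ONE certificate and ONE flow
pattern for conjecture BLOB-AFL at EVERY width and EVERY gate vector (`…/prim-quant-census-2-g80/TRIPLE-G80.md` §5), replacing the per-width regime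
lemmas; this file is its kernel half (certificate ⟹ heavy).  Conjecture C itself is NOT proved here.

HONEST STATUS.  Tool; BLOB-AFL open in the middle band beyond width 4; `SiblingStep`, `FarTreeRow`, `GluedLemmaW`, `GluedDominatedMass` OPEN; RATE
class (log\*) / honest sentence of `run/shared/lean/prim/quant/README.md` unchanged.  [this work].  Nothing here is cited as a published result.
The gluing rows served [cite: KozmaNitzan2024, Conjecture 3 (p. 15)]; product measure [cite: Grimmett1999, §1.3 p. 10].
-/

noncomputable section

open scoped BigOperators

namespace Summit.CriticalPhenomena.PercolationContinuityZ3.Theorems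
namespace Quant

open Finset

/-- the two-point law `{lo, hi; g}` (as in `…QuantLawDEC`) -/
local notation3 "TP[" lo ", " hi ", " g ", " h "]" =>
  (g : ℝ) * (if (h : ℕ) = (hi : ℕ) then (1 : ℝ) else 0) + (1 - (g : ℝ)) * (if (h : ℕ) = (lo : ℕ) then (1 : ℝ) else 0)

/-- the cheapest admissible gate of the pair `{l, h}` at floor `x`, target `T`: `max(x, (T − 2l)/(h − l))` -/
local notation3 "CG[" x ", " T ", " l ", " h "]" => max (x : ℝ) (((T : ℝ) - 2 * ((l : ℕ) : ℝ)) / (((h : ℕ) : ℝ) - ((l : ℕ) : ℝ)))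

namespace LawDec

/-- **HEAVY BY UNIFORM SPREADING.**  Let `μ ≥ 0` be a probability law on `{0..M}`, `0 ≤ x ≤ 1`, `T` a target, and `c ≥ 0` fractions with
`Σ_{l low} c l ≤ 1` such that every low atom `l` (`2l < T`) is served exactly by the fraction `c l` of its admissible high atoms `h > T − l` at the
cheapest gates `γ = max(x, (T−2l)/(h−l))`: `c l · Σ_{h ≤ M, h > T−l} μ h·(1−γ)/γ = μ l`.  Then `μ` carries a heavy decomposition at `(x, T)`.
[this work] -/
theorem heavy_of_uniformSpread (x T : ℝ) (M : ℕ) (μ c : ℕ → ℝ) (hx0 : 0 ≤ x) (hx1 : x ≤ 1) (hμ0 : ∀ h, 0 ≤ μ h)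
    (hμM : ∀ h, M < h → μ h = 0) (hμ1 : ∑ h ∈ Finset.range (M + 1), μ h = 1) (hc0 : ∀ l, 0 ≤ c l)
    (hc1 : ∑ l ∈ Finset.range (M + 1), (if 2 * (l : ℝ) < T then c l else 0) ≤ 1)
    (hserve : ∀ l : ℕ, l ≤ M → 2 * (l : ℝ) < T →
      c l * ∑ h ∈ Finset.range (M + 1),
        (if T - l < (h : ℝ) then μ h * (1 - CG[x, T, l, h]) / CG[x, T, l, h] else 0) = μ l) :
    ∃ (ι : Type) (_ : Fintype ι) (lam γ : ι → ℝ) (lo hi : ι → ℕ),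
      (∀ i, 0 ≤ lam i) ∧ (∑ i, lam i = 1) ∧ (∀ i, 0 ≤ γ i ∧ γ i ≤ 1) ∧ (∀ i, lo i ≤ hi i) ∧ (∀ i, hi i ≤ M) ∧
      (∀ h, μ h = ∑ i, lam i * TP[lo i, hi i, γ i, h]) ∧
      (∀ i, 0 < lam i → x ≤ γ i ∧ T ≤ 2 * (lo i : ℝ) + ((hi i : ℝ) - lo i) * γ i) := by
  classical
  -- facts about a charged pair
  have hpair : ∀ l h : ℕ, 2 * (l : ℝ) < T → T - l < (h : ℝ) →
      (l < h) ∧ 0 < CG[x, T, l, h] ∧ CG[x, T, l, h] ≤ 1 ∧ x ≤ CG[x, T, l, h] ∧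
        T ≤ 2 * (l : ℝ) + ((h : ℝ) - l) * CG[x, T, l, h] := by
    intro l h hl hh
    have hlh : (l : ℝ) < h := by linarith
    have hlh' : l < h := by exact_mod_cast hlh
    have hd : 0 < (h : ℝ) - l := by linarith
    have hq : 0 < (T - 2 * (l : ℝ)) / ((h : ℝ) - l) := div_pos (by linarith) hd
    refine ⟨hlh', lt_of_lt_of_le hq (le_max_right _ _), max_le hx1 ?_, le_max_left _ _, ?_⟩
    · rw [div_le_one hd]; linarith
    · have h1 : (T - 2 * (l : ℝ)) / ((h : ℝ) - l) ≤ CG[x, T, l, h] := le_max_right _ _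
      have h2 : ((h : ℝ) - l) * ((T - 2 * (l : ℝ)) / ((h : ℝ) - l)) = T - 2 * (l : ℝ) := by field_simp
      nlinarith [mul_le_mul_of_nonneg_left h1 hd.le]
  -- the weight table
  let w : ℕ → ℕ → ℝ := fun l h =>
    if 2 * (l : ℝ) < T ∧ T - l < (h : ℝ) ∧ h ≤ M then c l * μ h / CG[x, T, l, h] else 0
  have hw0 : ∀ l h, 0 ≤ w l h := by
    intro l h
    simp only [w]
    split_ifs with hc
    · exact div_nonneg (mul_nonneg (hc0 l) (hμ0 h)) (hpair l h hc.1 hc.2.1).2.1.le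
    · exact le_rfl
  refine heavy_of_pairWeights x T M μ w (fun l h => CG[x, T, l, h]) hx0 hx1 hμM hμ1 hw0 ?_ ?_ ?_
  · -- support
    intro l h hpos
    have hc : 2 * (l : ℝ) < T ∧ T - l < (h : ℝ) ∧ h ≤ M := by
      by_contra hn
      simp only [w, if_neg hn] at hpos
      exact lt_irrefl _ hpos
    obtain ⟨h1, _, h3, h4, h5⟩ := hpair l h hc.1 hc.2.1
    exact ⟨hc.1, h1, hc.2.2, h4, h3, h5⟩
  · -- lows are shipped exactly
    intro l hlM hl
    rw [← hserve l hlM hl, Finset.mul_sum]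
    refine Finset.sum_congr rfl fun h hh => ?_
    have hhM : h ≤ M := Nat.lt_succ_iff.1 (Finset.mem_range.1 hh)
    simp only [w]
    by_cases hadm : T - l < (h : ℝ)
    · rw [if_pos ⟨hl, hadm, hhM⟩, if_pos hadm]
      ring
    · rw [if_neg (fun hc => hadm hc.2.1), if_neg hadm]
      ring
  · -- highs are loaded by at most their mass
    intro h hhM _
    have e : ∀ l ∈ Finset.range (M + 1), w l h * CG[x, T, l, h]
        = (if 2 * (l : ℝ) < T ∧ T - l < (h : ℝ) ∧ h ≤ M then c l else 0) * μ h := by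
      intro l _
      simp only [w]
      split_ifs with hc
      · have hγ := (hpair l h hc.1 hc.2.1).2.1
        field_simp
      · ring
    rw [Finset.sum_congr rfl e, ← Finset.sum_mul]
    have hle : ∑ l ∈ Finset.range (M + 1), (if 2 * (l : ℝ) < T ∧ T - l < (h : ℝ) ∧ h ≤ M then c l else 0)
        ≤ ∑ l ∈ Finset.range (M + 1), (if 2 * (l : ℝ) < T then c l else 0) := by
      refine Finset.sum_le_sum fun l _ => ?_
      split_ifs with h1 h2 h2
      · exact le_rfl
      · exact absurd h1.1 h2
      · exact hc0 l
      · exact le_rfl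
    calc (∑ l ∈ Finset.range (M + 1), (if 2 * (l : ℝ) < T ∧ T - l < (h : ℝ) ∧ h ≤ M then c l else 0)) * μ h
        ≤ 1 * μ h := mul_le_mul_of_nonneg_right (hle.trans hc1) (hμ0 h)
      _ = μ h := one_mul _

/-- **hence DEC at every layer.** [this work] -/
theorem decAtT_of_uniformSpread (x T : ℝ) (M : ℕ) (μ c : ℕ → ℝ) (hx0 : 0 ≤ x) (hx1 : x ≤ 1) (hμ0 : ∀ h, 0 ≤ μ h)
    (hμM : ∀ h, M < h → μ h = 0) (hμ1 : ∑ h ∈ Finset.range (M + 1), μ h = 1) (hc0 : ∀ l, 0 ≤ c l)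
    (hc1 : ∑ l ∈ Finset.range (M + 1), (if 2 * (l : ℝ) < T then c l else 0) ≤ 1)
    (hserve : ∀ l : ℕ, l ≤ M → 2 * (l : ℝ) < T →
      c l * ∑ h ∈ Finset.range (M + 1),
        (if T - l < (h : ℝ) then μ h * (1 - CG[x, T, l, h]) / CG[x, T, l, h] else 0) = μ l) (j : ℕ) :
    DECAtT x T j M μ :=
  decAtT_of_heavy x T M μ (heavy_of_uniformSpread x T M μ c hx0 hx1 hμ0 hμM hμ1 hc0 hc1 hserve) j

end LawDec
end Quant
end Summit.CriticalPhenomena.PercolationContinuityZ3.Theorems
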